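import Summits.AtomisticToContinuum.BoseEinsteinCondensation.Theorems.BECConjugateDominationHardCoreExtensionAlphaPair
import Summits.AtomisticToContinuum.BoseEinsteinCondensation.Theorems.BECConjugateDominationHardCoreExtensionAlphaSoft
import Summits.AtomisticToContinuum.BoseEinsteinCondensation.Theorems.BECConjugateDominationHardCoreExtensionPairCutoffUniform
import Summits.AtomisticToContinuum.BoseEinsteinCondensation.Theorems.BECConjugateDominationHardCoreExtensionAlphaPairBookkeepingSoft
import HarnessLib

/-!
# (α'₂) for SOFT cores: truncation convergence of the Ky Fan two-level with a variable core radius `δ → 0`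
# (line `third-law-current-floor`, crux `HardCoreExtension`, stmt-AtomisticToContinuum-11786, lead c1, cycle 2)

Registered composition node `stub_truncationKyFanConvergenceSoft_of`: (kinetic tightness of near-optimal pairs along the
truncations = conclusion of `stub_pairKineticTightness_of`) → (P4U `stub_pairShellMassBoundUniform`) → for every admissible `v`
of the SOFT-CORE class (inner radius `a ≥ 0`, scale `a₀`: `v` bounded on every `(a+δ,∞)`, `δ ∈ (0,a₀]`, and `v ≥ C/δ²` on
`[0,a+δ)` for every `C` at suitably small `δ`), every `N`, `L > 4(a+a₀)`, `kyFanTwo v N L < ⊤`, `ε > 0`: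
`kyFanTwo v N L ≤ kyFanTwo (min(v,n)) N L + ε` for all large `n`. Proof = `…AlphaPair.lean` with the core radius `δ` chosen
AFTER `ε` as in `…AlphaSoft.lean` (uniform pair cut-off `stub_pairCutoffExistsUniform` at radius `a+δ`, width `δ`; the
repulsion `v ≥ C_big/δ²` penalises the core mass, `AlphaSoft.ofReal_mul_coreMass_le_energy`; Gram–Schmidt
`stub_gramSchmidtPair`, overlap `stub_cutStatesOverlap`, bookkeeping `AlphaPair.final_ennreal_ofReal`). [folklore]
-/

noncomputable section

namespace Summit.AtomisticToContinuum.BoseEinsteinCondensation.Cruxes.HardCoreExtension.ThirdLawCurrentFloor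

open MeasureTheory Filter
open scoped ENNReal NNReal BigOperators Topology ComplexConjugate
open Literature.MathematicalPhysics.QuantumManyBody.BoseGas
open AlphaPhys AlphaSoft AlphaPair TraceCauchy

namespace AlphaSoftPair

/-- The parameters `θ, η₀, ε₁` of the two-state cut-off argument and their defining inequalities. [folklore] -/
theorem pair_parameters {Kr ε Cs Cχ A : ℝ} (hKr : 0 ≤ Kr) (hε : 0 < ε) (hCs : 0 ≤ Cs) (hCχ : 0 ≤ Cχ) :
    ∃ θ η₀ ε₁ : ℝ, 0 < θ ∧ θ * (8 * (Kr + 1)) ≤ ε ∧ 0 < η₀ ∧ η₀ ≤ 1 / 8 ∧ η₀ * (256 * (1 + θ) * (Kr + 1)) ≤ ε ∧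
      0 < ε₁ ∧ ε₁ * (2 * (Cs + 1) * (A ^ 2 + 1)) ≤ η₀ ∧ ε₁ * (40 * (Cχ * Cs + 1) * (1 + θ)) ≤ ε * θ := by
  set θ : ℝ := ε / (8 * (Kr + 1)) with hθdef
  have hθ : 0 < θ := by positivity
  set η₀ : ℝ := min (1 / 8) (ε / (256 * (1 + θ) * (Kr + 1))) with hη₀def
  have hη₀pos : 0 < η₀ := lt_min (by norm_num) (by positivity)
  set ε₁ : ℝ := min (η₀ / (2 * (Cs + 1) * (A ^ 2 + 1))) (ε * θ / (40 * (Cχ * Cs + 1) * (1 + θ))) with hε₁def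
  refine ⟨θ, η₀, ε₁, hθ, ?_, hη₀pos, min_le_left _ _, ?_, lt_min (by positivity) (by positivity), ?_, ?_⟩
  · have : θ * (8 * (Kr + 1)) = ε := by rw [hθdef]; field_simp
    exact this.le
  · have h := min_le_right (1 / 8 : ℝ) (ε / (256 * (1 + θ) * (Kr + 1)))
    rwa [← hη₀def, le_div_iff₀ (by positivity)] at h
  · have h := min_le_left (η₀ / (2 * (Cs + 1) * (A ^ 2 + 1))) (ε * θ / (40 * (Cχ * Cs + 1) * (1 + θ)))
    rwa [← hε₁def, le_div_iff₀ (by positivity)] at h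
  · have h := min_le_right (η₀ / (2 * (Cs + 1) * (A ^ 2 + 1))) (ε * θ / (40 * (Cχ * Cs + 1) * (1 + θ)))
    rwa [← hε₁def, le_div_iff₀ (by positivity)] at h

/-- The penalisation constant `C_big` of the soft-core argument, chosen BEFORE the core radius `δ ≤ a₀`: with `V = C_big/δ²`,
`2(1+Cs)(Kr+1) ≤ η₀V` and `80(1+θ)CχCs(Kr+1) ≤ εθδ²V`. [folklore] -/
theorem soft_penalisation {Kr ε θ η₀ Cs Cχ a₀ : ℝ} (hKr : 0 ≤ Kr) (hε : 0 < ε) (hθ : 0 < θ) (hη₀ : 0 < η₀)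
    (hCs : 0 ≤ Cs) (hCχ : 0 ≤ Cχ) :
    ∃ Cbig : ℝ, 0 < Cbig ∧ ∀ δ : ℝ, 0 < δ → δ ≤ a₀ →
      2 * (1 + Cs) * (Kr + 1) ≤ η₀ * (Cbig / δ ^ 2) ∧ 80 * (1 + θ) * Cχ * Cs * (Kr + 1) ≤ ε * θ * δ ^ 2 * (Cbig / δ ^ 2) := by
  set R₁ : ℝ := 2 * (1 + Cs) * (Kr + 1) / η₀ with hR₁
  set R₃ : ℝ := 80 * (1 + θ) * Cχ * Cs * (Kr + 1) / (ε * θ) with hR₃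
  have hR₁0 : 0 ≤ R₁ := by positivity
  have hR₃0 : 0 ≤ R₃ := by positivity
  refine ⟨R₁ * a₀ ^ 2 + R₃ + 1, by positivity, fun δ hδ hδa₀ => ⟨?_, ?_⟩⟩
  · have hδ2 : δ ^ 2 ≤ a₀ ^ 2 := pow_le_pow_left₀ hδ.le hδa₀ 2
    have h1 : R₁ * δ ^ 2 ≤ R₁ * a₀ ^ 2 + R₃ + 1 := by nlinarith
    have h2 : R₁ ≤ (R₁ * a₀ ^ 2 + R₃ + 1) / δ ^ 2 := by rw [le_div_iff₀ (by positivity)]; exact h1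
    have h3 : 2 * (1 + Cs) * (Kr + 1) = η₀ * R₁ := by rw [hR₁]; field_simp
    rw [h3]; exact mul_le_mul_of_nonneg_left h2 hη₀.le
  · have h1 : ε * θ * δ ^ 2 * ((R₁ * a₀ ^ 2 + R₃ + 1) / δ ^ 2) = ε * θ * (R₁ * a₀ ^ 2 + R₃ + 1) := by
      field_simp
    have h3 : 80 * (1 + θ) * Cχ * Cs * (Kr + 1) = ε * θ * R₃ := by rw [hR₃]; field_simp
    rw [h1, h3]
    exact mul_le_mul_of_nonneg_left (by linarith [mul_nonneg hR₁0 (sq_nonneg a₀)]) (by positivity)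

end AlphaSoftPair

open AlphaSoftPair

/-! ### The assembly -/

/-- **(α'₂) on the soft-core class, closed modulo two inputs** — registered composition node of the line
`third-law-current-floor` (see the module docstring). [folklore] -/
theorem stub_truncationKyFanConvergenceSoft_of :
    (∀ (v : ℝ → ℝ≥0∞), Measurable v → ∀ (N : ℕ) (L : ℝ), 0 < L → ∀ B : ℝ≥0∞, B ≠ ⊤ →
      ∀ Ψ₁ Ψ₂ : ℕ → PeriodicTrialState N L,
        (∀ n : ℕ, ∫ X in cellN N L, conj ((Ψ₁ n).ψ X) * (Ψ₂ n).ψ X = 0) →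
        (∀ n : ℕ, periodicEnergy (fun r => min (v r) (n : ℝ≥0∞)) (Ψ₁ n) +
            periodicEnergy (fun r => min (v r) (n : ℝ≥0∞)) (Ψ₂ n) ≤
          kyFanTwo (fun r => min (v r) (n : ℝ≥0∞)) N L + ENNReal.ofReal (1 / ((n : ℝ) + 1))) →
        (∀ n : ℕ, kyFanTwo (fun r => min (v r) (n : ℝ≥0∞)) N L ≤ B) →
        ∃ φ : ℕ → ℕ, StrictMono φ ∧
          ∀ S : ℕ → Set (Config N), (∀ k, MeasurableSet (S k)) → Antitone S →
            volume ((⋂ k, S k) ∩ cellN N L) = 0 →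
            ∀ ε : ℝ, 0 < ε → ∃ k₀ i₀ : ℕ, ∀ k i : ℕ, k₀ ≤ k → i₀ ≤ i →
              ∫⁻ X in S k ∩ cellN N L, kineticDensity (Ψ₁ (φ i)).ψ X + kineticDensity (Ψ₂ (φ i)).ψ X ≤
                ENNReal.ofReal ε) →
    (∀ (N : ℕ) (L a₀ : ℝ), 0 < L → 0 < a₀ → 4 * a₀ < L → ∃ C : ℝ, 0 ≤ C ∧
      ∀ a ℓ : ℝ, 0 < ℓ → ℓ ≤ a → a ≤ a₀ →
      ∀ Ψ : Config N → ℂ, ContDiff ℝ 1 Ψ →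
        (∀ (X : Config N) (i : Fin N) (k : Fin 3), Ψ (X + Pi.single i (EuclideanSpace.single k L)) = Ψ X) →
        ∫⁻ X in {X : Config N | ∃ i j : Fin N, i ≠ j ∧ ∃ n : Fin 3 → ℤ,
            a < ‖X i - X j - latticeVec L n‖ ∧ ‖X i - X j - latticeVec L n‖ < a + ℓ} ∩ cellN N L,
            (‖Ψ X‖₊ : ℝ≥0∞) ^ 2 ≤
          ENNReal.ofReal C *
              (∫⁻ X in {X : Config N | ∃ i j : Fin N, i ≠ j ∧ ∃ n : Fin 3 → ℤ,
                  a - ℓ < ‖X i - X j - latticeVec L n‖ ∧ ‖X i - X j - latticeVec L n‖ ≤ a} ∩ cellN N L,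
                  (‖Ψ X‖₊ : ℝ≥0∞) ^ 2) +
            ENNReal.ofReal (C * ℓ ^ 2) *
              ∫⁻ X in {X : Config N | ∃ i j : Fin N, i ≠ j ∧ ∃ n : Fin 3 → ℤ,
                  a - ℓ < ‖X i - X j - latticeVec L n‖ ∧ ‖X i - X j - latticeVec L n‖ < a + ℓ} ∩ cellN N L,
                  kineticDensity Ψ X) →
    ∀ (v : ℝ → ℝ≥0∞) (a a₀ : ℝ), IsRepulsiveFiniteRange v → 0 ≤ a → 0 < a₀ →
      (∀ δ : ℝ, 0 < δ → δ ≤ a₀ → ∃ M : ℝ≥0∞, M ≠ ⊤ ∧ ∀ r, a + δ < r → v r ≤ M) →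
      (∀ (C δ₁ : ℝ), 0 < δ₁ → ∃ δ : ℝ, 0 < δ ∧ δ ≤ δ₁ ∧ δ ≤ a₀ ∧
        ∀ r, 0 ≤ r → r < a + δ → ENNReal.ofReal (C / δ ^ 2) ≤ v r) →
      ∀ (N : ℕ) (L : ℝ), 4 * (a + a₀) < L → kyFanTwo v N L ≠ ⊤ →
      ∀ ε : ℝ, 0 < ε → ∃ n₀ : ℕ, ∀ n : ℕ, n₀ ≤ n →
        kyFanTwo v N L ≤ kyFanTwo (fun r => min (v r) (n : ℝ≥0∞)) N L + ENNReal.ofReal ε := by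
  intro hpt hshellU v a a₀ hv ha ha₀ htail hsoft N L h4a hK ε hε
  have hL : 0 < L := by linarith
  have haa₀ : 0 < a + a₀ := by linarith
  -- the truncation levels lie below `K = K₂(v)`
  have hKn : ∀ n : ℕ, kyFanTwo (fun r => min (v r) (n : ℝ≥0∞)) N L ≤ kyFanTwo v N L := fun n =>
    kyFanTwo_mono_of_le fun r => min_le_left _ _
  -- `1/(n+1)`-optimal orthogonal pairs of every truncation
  have hpairs : ∀ n : ℕ, ∃ Ψ₁ Ψ₂ : PeriodicTrialState N L, (∫ X in cellN N L, conj (Ψ₁.ψ X) * Ψ₂.ψ X = 0) ∧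
      periodicEnergy (fun r => min (v r) (n : ℝ≥0∞)) Ψ₁ + periodicEnergy (fun r => min (v r) (n : ℝ≥0∞)) Ψ₂ ≤
        kyFanTwo (fun r => min (v r) (n : ℝ≥0∞)) N L + ENNReal.ofReal (1 / ((n : ℝ) + 1)) := fun n =>
    exists_pair_le_add (ne_top_of_le_ne_top hK (hKn n))
      (ENNReal.ofReal_pos.2 (by positivity : (0 : ℝ) < 1 / ((n : ℝ) + 1))).ne'
  choose Ψ₁ Ψ₂ horth hopt using hpairs
  -- the Rellich subsequence with tight pair kinetic energy
  obtain ⟨φ, hφ, hT⟩ := hpt v hv.1 N L hL _ hK Ψ₁ Ψ₂ horth hopt hKn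
  -- the layers, shrinking to the null wall
  set S : ℕ → Set (Config N) := fun kk => {X : Config N | ∃ i j : Fin N, i ≠ j ∧
      ∃ n : Fin 3 → ℤ, a - 1 / ((kk : ℝ) + 1) < ‖X i - X j - latticeVec L n‖ ∧
        ‖X i - X j - latticeVec L n‖ < a + 1 / ((kk : ℝ) + 1)} with hSdef
  have hSm : ∀ kk, MeasurableSet (S kk) := fun kk =>
    measurableSet_pairImage (S := Set.Ioo (a - 1 / ((kk : ℝ) + 1)) (a + 1 / ((kk : ℝ) + 1))) L
      measurableSet_Ioo
  have hSanti : Antitone S := by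
    intro k₁ k₂ hk X hX
    obtain ⟨i, j, hij, n, h1, h2⟩ := hX
    have hmono : (1 : ℝ) / ((k₂ : ℝ) + 1) ≤ 1 / ((k₁ : ℝ) + 1) :=
      one_div_le_one_div_of_le (by positivity) (by exact_mod_cast Nat.succ_le_succ hk)
    exact ⟨i, j, hij, n, by linarith, by linarith⟩
  have hSnull : volume ((⋂ kk, S kk) ∩ cellN N L) = 0 := by
    refine measure_mono_null Set.inter_subset_left ?_
    rw [hSdef, iInter_layer_eq_wall hL a]
    exact volume_wall_eq_zero N L a
  have hT' := hT S hSm hSanti hSnull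
  -- constants of the cut-off and of the shell bound
  obtain ⟨Cχ, hCχ0, hcutℓ⟩ := stub_pairCutoffExistsUniform N L (a + a₀) hL haa₀
  obtain ⟨Cs, hCs0, hshellℓ⟩ := hshellU N L (a + a₀) hL haa₀ h4a
  -- the parameters `θ`, `η₀`, `ε₁`
  set Kr : ℝ := (kyFanTwo v N L).toReal with hKrdef
  have hKr : 0 ≤ Kr := ENNReal.toReal_nonneg
  obtain ⟨θ, η₀, ε₁, hθ, hθK, hη₀pos, hη₀a, hη₀b, hε₁, hε₁a, hε₁b⟩ :=
    pair_parameters (A := a + a₀) hKr hε hCs0 hCχ0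
  -- the layer index `k₀`, the subsequence index `i₀`; the penalisation constant `C_big`, the core radius `δ` (= shell width)
  obtain ⟨k₀, i₀, hki⟩ := hT' ε₁ hε₁
  set R₂ : ℝ := 40 * (1 + θ) / ε with hR₂
  obtain ⟨Cbig, hCbig0, hCbigδ⟩ := soft_penalisation (a₀ := a₀) hKr hε hθ hη₀pos hCs0 hCχ0
  obtain ⟨δ, hδ, hδk, hδa₀, hcoreδ⟩ := hsoft Cbig (1 / (2 * ((k₀ : ℝ) + 1))) (by positivity)
  obtain ⟨M, hMtop, hM⟩ := htail δ hδ hδa₀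
  have hδR : δ ≤ a + δ := by linarith
  obtain ⟨hRa₀, hℓa⟩ : a + δ ≤ a + a₀ ∧ δ ≤ a + a₀ := ⟨by linarith, by linarith⟩
  obtain ⟨χ, hχ1, hχper, hχsymm, hχ01, hχ0, hχfar1, hχC, hχfar⟩ := hcutℓ (a + δ) δ hδ hδR hRa₀
  set V : ℝ := Cbig / δ ^ 2 with hVdef
  have hV : 0 < V := by positivity
  obtain ⟨hm1, hm3⟩ := hCbigδ δ hδ hδa₀
  -- the truncation level `m = φ i`: above `M`, `V` and the slack threshold `R₂`
  set i : ℕ := max i₀ (⌈max M.toReal (max V R₂)⌉₊ + 1) with hidef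
  have hi₀ : i₀ ≤ i := le_max_left _ _
  have hiR : max M.toReal (max V R₂) < (i : ℝ) := by
    have h1 : max M.toReal (max V R₂) ≤ (⌈max M.toReal (max V R₂)⌉₊ : ℝ) := Nat.le_ceil _
    have h2 : ((⌈max M.toReal (max V R₂)⌉₊ + 1 : ℕ) : ℝ) ≤ (i : ℝ) := by exact_mod_cast le_max_right _ _
    push_cast at h2
    linarith
  have him : (i : ℝ) ≤ (φ i : ℝ) := by exact_mod_cast hφ.le_apply
  have hMR := le_max_left M.toReal (max V R₂)
  have hVR := (le_max_left V R₂).trans (le_max_right M.toReal (max V R₂))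
  have hR₂R := (le_max_right V R₂).trans (le_max_right M.toReal (max V R₂))
  have hmpos : (0 : ℝ) < (φ i : ℝ) := by linarith [(ENNReal.toReal_nonneg : (0 : ℝ) ≤ M.toReal)]
  have hMm : M ≤ ((φ i : ℕ) : ℝ≥0∞) := by
    have h : M.toReal ≤ ((φ i : ℕ) : ℝ) := by linarith
    calc M = ENNReal.ofReal M.toReal := (ENNReal.ofReal_toReal hMtop).symm
      _ ≤ ENNReal.ofReal ((φ i : ℕ) : ℝ) := ENNReal.ofReal_le_ofReal h
      _ = ((φ i : ℕ) : ℝ≥0∞) := ENNReal.ofReal_natCast _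
  have hVm : ENNReal.ofReal V ≤ ((φ i : ℕ) : ℝ≥0∞) := by
    have h : V ≤ ((φ i : ℕ) : ℝ) := by linarith
    calc ENNReal.ofReal V ≤ ENNReal.ofReal ((φ i : ℕ) : ℝ) := ENNReal.ofReal_le_ofReal h
      _ = ((φ i : ℕ) : ℝ≥0∞) := ENNReal.ofReal_natCast _
  have hm2 : 40 * (1 + θ) ≤ ε * ((φ i : ℝ) + 1) := by
    have h : R₂ ≤ (φ i : ℝ) := by linarith
    rw [hR₂, div_le_iff₀ hε] at h
    have hid : ε * ((φ i : ℝ) + 1) = (φ i : ℝ) * ε + ε := by ring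
    rw [hid]
    linarith
  -- the cut states `u_j = χ Ψ_j`, `Ψ_j` the near-optimal pair of the `m`-th truncation
  have hχc1 : ContDiff ℝ 1 (fun Y : Config N => (χ Y : ℂ)) := Complex.ofRealCLM.contDiff.comp hχ1
  have hu : ∀ Φ : PeriodicTrialState N L, ContDiff ℝ 1 (fun Y : Config N => (χ Y : ℂ) * Φ.ψ Y) := fun Φ =>
    hχc1.mul Φ.contDiff
  have huper : ∀ (Φ : PeriodicTrialState N L) (X : Config N) (i' : Fin N) (k' : Fin 3),
      (fun Y : Config N => (χ Y : ℂ) * Φ.ψ Y) (X + Pi.single i' (EuclideanSpace.single k' L)) =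
        (fun Y : Config N => (χ Y : ℂ) * Φ.ψ Y) X := fun Φ X i' k' => by
    simp only [hχper X i' k', Φ.periodic X i' k']
  have husymm : ∀ (Φ : PeriodicTrialState N L) (σ : Equiv.Perm (Fin N)) (X : Config N),
      (fun Y : Config N => (χ Y : ℂ) * Φ.ψ Y) (X ∘ σ) = (fun Y : Config N => (χ Y : ℂ) * Φ.ψ Y) X := fun Φ σ X => by
    simp only [hχsymm σ X, Φ.symm σ X]
  -- the `ℝ≥0∞` facts, state by state
  have h4E₁ := cutState_form_le (N := N) (L := L) hv.1 hM hMm (Ψ₁ (φ i)) hχ1 hχ01 hχ0 hχC hχfar hθ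
  have h4E₂ := cutState_form_le (N := N) (L := L) hv.1 hM hMm (Ψ₂ (φ i)) hχ1 hχ01 hχ0 hχC hχfar hθ
  have h2E₁ := (one_le_mass_cutState_add (N := N) (L := L) (Ψ₁ (φ i)) hχfar1).trans
    (add_le_add_left (add_le_add_right (setLIntegral_hardSet_le_open N L (a + δ) _) _) _)
  have h2E₂ := (one_le_mass_cutState_add (N := N) (L := L) (Ψ₂ (φ i)) hχfar1).trans
    (add_le_add_left (add_le_add_right (setLIntegral_hardSet_le_open N L (a + δ) _) _) _)
  have hμ1₁ := mass_cutState_le_one (N := N) (L := L) (Ψ₁ (φ i)) hχ01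
  have hμ1₂ := mass_cutState_le_one (N := N) (L := L) (Ψ₂ (φ i)) hχ01
  have hcoreE₁ := ofReal_mul_coreMass_le_energy (N := N) (L := L) hcoreδ hVm (Ψ₁ (φ i))
  have hcoreE₂ := ofReal_mul_coreMass_le_energy (N := N) (L := L) hcoreδ hVm (Ψ₂ (φ i))
  have hmass1 : ∀ (Φ : PeriodicTrialState N L) (s : Set (Config N)),
      ∫⁻ X in s ∩ cellN N L, ((‖Φ.ψ X‖₊ : ℝ≥0∞)) ^ 2 ≤ 1 := fun Φ s =>
    (lintegral_mono_set Set.inter_subset_right).trans Φ.norm_eq.le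
  have hinnerE : ∀ Φ : PeriodicTrialState N L,
      ∫⁻ X in {X : Config N | ∃ i j : Fin N, i ≠ j ∧ ∃ n : Fin 3 → ℤ,
        a + δ - δ < ‖X i - X j - latticeVec L n‖ ∧ ‖X i - X j - latticeVec L n‖ ≤ a + δ} ∩ cellN N L,
        ((‖Φ.ψ X‖₊ : ℝ≥0∞)) ^ 2 ≤
      ∫⁻ X in {X : Config N | ∃ i j : Fin N, i ≠ j ∧ ∃ n : Fin 3 → ℤ,
        ‖X i - X j - latticeVec L n‖ < a + δ} ∩ cellN N L, ((‖Φ.ψ X‖₊ : ℝ≥0∞)) ^ 2 := by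
    intro Φ
    refine le_trans (lintegral_mono_set (Set.inter_subset_inter_left _ ?_))
      (setLIntegral_hardSet_le_open N L (a + δ) _)
    rintro X ⟨i', j', hij, n, -, h2⟩
    exact ⟨i', j', hij, n, h2⟩
  have hshellE₁ := hshellℓ (a + δ) δ hδ hδR hRa₀ (Ψ₁ (φ i)).ψ (Ψ₁ (φ i)).contDiff (Ψ₁ (φ i)).periodic
  have hshellE₂ := hshellℓ (a + δ) δ hδ hδR hRa₀ (Ψ₂ (φ i)).ψ (Ψ₂ (φ i)).contDiff (Ψ₂ (φ i)).periodic
  have hKlE : (∫⁻ X in {X : Config N | ∃ i j : Fin N, i ≠ j ∧ ∃ n : Fin 3 → ℤ,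
        a + δ - δ < ‖X i - X j - latticeVec L n‖ ∧ ‖X i - X j - latticeVec L n‖ < a + δ + δ} ∩ cellN N L,
        kineticDensity (Ψ₁ (φ i)).ψ X) +
      (∫⁻ X in {X : Config N | ∃ i j : Fin N, i ≠ j ∧ ∃ n : Fin 3 → ℤ,
        a + δ - δ < ‖X i - X j - latticeVec L n‖ ∧ ‖X i - X j - latticeVec L n‖ < a + δ + δ} ∩ cellN N L,
        kineticDensity (Ψ₂ (φ i)).ψ X) ≤ ENNReal.ofReal ε₁ := by
    have hδk' : δ + δ ≤ 1 / ((k₀ : ℝ) + 1) := by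
      have h0 : (0 : ℝ) < (k₀ : ℝ) + 1 := by positivity
      have h := hδk
      rw [le_div_iff₀ (by positivity)] at h
      rw [le_div_iff₀ h0]
      linarith
    have hpos : (0 : ℝ) < 1 / ((k₀ : ℝ) + 1) := by positivity
    rw [← lintegral_add_left (measurable_kineticDensity_of_any _)]
    refine le_trans (lintegral_mono_set (Set.inter_subset_inter_left _ ?_)) (hki k₀ i le_rfl hi₀)
    rintro X ⟨i', j', hij, n, h1, h2⟩
    exact ⟨i', j', hij, n, by linarith, by linarith⟩
  have hovE := stub_cutStatesOverlap N L (a + δ) δ χ hχ1.continuous hχ01 hχfar1 (Ψ₁ (φ i)) (Ψ₂ (φ i)) (horth (φ i))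
  -- aggregated facts (sums over the two states)
  have hE : periodicEnergy (fun r => min (v r) ((φ i : ℕ) : ℝ≥0∞)) (Ψ₁ (φ i)) + periodicEnergy (fun r => min (v r) ((φ i : ℕ) : ℝ≥0∞)) (Ψ₂ (φ i)) ≤ kyFanTwo v N L + 1 :=
    (hopt (φ i)).trans (add_le_add (hKn (φ i)) (by
      rw [← ENNReal.ofReal_one]
      exact ENNReal.ofReal_le_ofReal (by rw [div_le_one (by positivity)]; linarith)))
  have hcoreA : ENNReal.ofReal V * ((∫⁻ X in {X : Config N | ∃ i j : Fin N, i ≠ j ∧ ∃ n : Fin 3 → ℤ,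
        ‖X i - X j - latticeVec L n‖ < a + δ} ∩ cellN N L, ((‖(Ψ₁ (φ i)).ψ X‖₊ : ℝ≥0∞)) ^ 2) + (∫⁻ X in {X : Config N | ∃ i j : Fin N, i ≠ j ∧ ∃ n : Fin 3 → ℤ,
        ‖X i - X j - latticeVec L n‖ < a + δ} ∩ cellN N L, ((‖(Ψ₂ (φ i)).ψ X‖₊ : ℝ≥0∞)) ^ 2)) ≤ periodicEnergy (fun r => min (v r) ((φ i : ℕ) : ℝ≥0∞)) (Ψ₁ (φ i)) + periodicEnergy (fun r => min (v r) ((φ i : ℕ) : ℝ≥0∞)) (Ψ₂ (φ i)) := by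
    rw [mul_add]; exact add_le_add hcoreE₁ hcoreE₂
  have hinnerA : (∫⁻ X in {X : Config N | ∃ i j : Fin N, i ≠ j ∧ ∃ n : Fin 3 → ℤ,
        a + δ - δ < ‖X i - X j - latticeVec L n‖ ∧ ‖X i - X j - latticeVec L n‖ ≤ a + δ} ∩ cellN N L, ((‖(Ψ₁ (φ i)).ψ X‖₊ : ℝ≥0∞)) ^ 2) + (∫⁻ X in {X : Config N | ∃ i j : Fin N, i ≠ j ∧ ∃ n : Fin 3 → ℤ,
        a + δ - δ < ‖X i - X j - latticeVec L n‖ ∧ ‖X i - X j - latticeVec L n‖ ≤ a + δ} ∩ cellN N L, ((‖(Ψ₂ (φ i)).ψ X‖₊ : ℝ≥0∞)) ^ 2) ≤ (∫⁻ X in {X : Config N | ∃ i j : Fin N, i ≠ j ∧ ∃ n : Fin 3 → ℤ,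
        ‖X i - X j - latticeVec L n‖ < a + δ} ∩ cellN N L, ((‖(Ψ₁ (φ i)).ψ X‖₊ : ℝ≥0∞)) ^ 2) + (∫⁻ X in {X : Config N | ∃ i j : Fin N, i ≠ j ∧ ∃ n : Fin 3 → ℤ,
        ‖X i - X j - latticeVec L n‖ < a + δ} ∩ cellN N L, ((‖(Ψ₂ (φ i)).ψ X‖₊ : ℝ≥0∞)) ^ 2) :=
    add_le_add (hinnerE _) (hinnerE _)
  have hshellA : (∫⁻ X in {X : Config N | ∃ i j : Fin N, i ≠ j ∧ ∃ n : Fin 3 → ℤ,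
        a + δ < ‖X i - X j - latticeVec L n‖ ∧ ‖X i - X j - latticeVec L n‖ < a + δ + δ} ∩ cellN N L, ((‖(Ψ₁ (φ i)).ψ X‖₊ : ℝ≥0∞)) ^ 2) + (∫⁻ X in {X : Config N | ∃ i j : Fin N, i ≠ j ∧ ∃ n : Fin 3 → ℤ,
        a + δ < ‖X i - X j - latticeVec L n‖ ∧ ‖X i - X j - latticeVec L n‖ < a + δ + δ} ∩ cellN N L, ((‖(Ψ₂ (φ i)).ψ X‖₊ : ℝ≥0∞)) ^ 2) ≤
      ENNReal.ofReal Cs * ((∫⁻ X in {X : Config N | ∃ i j : Fin N, i ≠ j ∧ ∃ n : Fin 3 → ℤ,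
        a + δ - δ < ‖X i - X j - latticeVec L n‖ ∧ ‖X i - X j - latticeVec L n‖ ≤ a + δ} ∩ cellN N L, ((‖(Ψ₁ (φ i)).ψ X‖₊ : ℝ≥0∞)) ^ 2) + (∫⁻ X in {X : Config N | ∃ i j : Fin N, i ≠ j ∧ ∃ n : Fin 3 → ℤ,
        a + δ - δ < ‖X i - X j - latticeVec L n‖ ∧ ‖X i - X j - latticeVec L n‖ ≤ a + δ} ∩ cellN N L, ((‖(Ψ₂ (φ i)).ψ X‖₊ : ℝ≥0∞)) ^ 2)) + ENNReal.ofReal (Cs * δ ^ 2) * ((∫⁻ X in {X : Config N | ∃ i j : Fin N, i ≠ j ∧ ∃ n : Fin 3 → ℤ,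
        a + δ - δ < ‖X i - X j - latticeVec L n‖ ∧ ‖X i - X j - latticeVec L n‖ < a + δ + δ} ∩ cellN N L,
        kineticDensity (Ψ₁ (φ i)).ψ X) + (∫⁻ X in {X : Config N | ∃ i j : Fin N, i ≠ j ∧ ∃ n : Fin 3 → ℤ,
        a + δ - δ < ‖X i - X j - latticeVec L n‖ ∧ ‖X i - X j - latticeVec L n‖ < a + δ + δ} ∩ cellN N L,
        kineticDensity (Ψ₂ (φ i)).ψ X)) :=
    calc _ ≤ _ := add_le_add hshellE₁ hshellE₂
      _ = _ := by ring
  have h112 : (1 : ℝ≥0∞) + 1 = 2 := by norm_num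
  have hmK2 :
      (∫⁻ X in {X : Config N | ∃ i j : Fin N, i ≠ j ∧ ∃ n : Fin 3 → ℤ,
        ‖X i - X j - latticeVec L n‖ < a + δ} ∩ cellN N L, ((‖(Ψ₁ (φ i)).ψ X‖₊ : ℝ≥0∞)) ^ 2) + (∫⁻ X in {X : Config N | ∃ i j : Fin N, i ≠ j ∧ ∃ n : Fin 3 → ℤ,
        ‖X i - X j - latticeVec L n‖ < a + δ} ∩ cellN N L, ((‖(Ψ₂ (φ i)).ψ X‖₊ : ℝ≥0∞)) ^ 2) ≤ 2 := (add_le_add (hmass1 _ _) (hmass1 _ _)).trans_eq h112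
  have hmO2 : (∫⁻ X in {X : Config N | ∃ i j : Fin N, i ≠ j ∧ ∃ n : Fin 3 → ℤ,
        a + δ < ‖X i - X j - latticeVec L n‖ ∧ ‖X i - X j - latticeVec L n‖ < a + δ + δ} ∩ cellN N L, ((‖(Ψ₁ (φ i)).ψ X‖₊ : ℝ≥0∞)) ^ 2) + (∫⁻ X in {X : Config N | ∃ i j : Fin N, i ≠ j ∧ ∃ n : Fin 3 → ℤ,
        a + δ < ‖X i - X j - latticeVec L n‖ ∧ ‖X i - X j - latticeVec L n‖ < a + δ + δ} ∩ cellN N L, ((‖(Ψ₂ (φ i)).ψ X‖₊ : ℝ≥0∞)) ^ 2) ≤ 2 := (add_le_add (hmass1 _ _) (hmass1 _ _)).trans_eq h112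
  -- the lost mass `η`
  have hηfin : (∫⁻ X in {X : Config N | ∃ i j : Fin N, i ≠ j ∧ ∃ n : Fin 3 → ℤ,
        ‖X i - X j - latticeVec L n‖ < a + δ} ∩ cellN N L, ((‖(Ψ₁ (φ i)).ψ X‖₊ : ℝ≥0∞)) ^ 2) + (∫⁻ X in {X : Config N | ∃ i j : Fin N, i ≠ j ∧ ∃ n : Fin 3 → ℤ,
        ‖X i - X j - latticeVec L n‖ < a + δ} ∩ cellN N L, ((‖(Ψ₂ (φ i)).ψ X‖₊ : ℝ≥0∞)) ^ 2) + ((∫⁻ X in {X : Config N | ∃ i j : Fin N, i ≠ j ∧ ∃ n : Fin 3 → ℤ,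
        a + δ < ‖X i - X j - latticeVec L n‖ ∧ ‖X i - X j - latticeVec L n‖ < a + δ + δ} ∩ cellN N L, ((‖(Ψ₁ (φ i)).ψ X‖₊ : ℝ≥0∞)) ^ 2) + (∫⁻ X in {X : Config N | ∃ i j : Fin N, i ≠ j ∧ ∃ n : Fin 3 → ℤ,
        a + δ < ‖X i - X j - latticeVec L n‖ ∧ ‖X i - X j - latticeVec L n‖ < a + δ + δ} ∩ cellN N L, ((‖(Ψ₂ (φ i)).ψ X‖₊ : ℝ≥0∞)) ^ 2)) ≠ ⊤ :=
    ENNReal.add_ne_top.2 ⟨ne_top_of_le_ne_top ENNReal.ofNat_ne_top hmK2, ne_top_of_le_ne_top ENNReal.ofNat_ne_top hmO2⟩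
  set η : ℝ := ((∫⁻ X in {X : Config N | ∃ i j : Fin N, i ≠ j ∧ ∃ n : Fin 3 → ℤ,
        ‖X i - X j - latticeVec L n‖ < a + δ} ∩ cellN N L, ((‖(Ψ₁ (φ i)).ψ X‖₊ : ℝ≥0∞)) ^ 2) + (∫⁻ X in {X : Config N | ∃ i j : Fin N, i ≠ j ∧ ∃ n : Fin 3 → ℤ,
        ‖X i - X j - latticeVec L n‖ < a + δ} ∩ cellN N L, ((‖(Ψ₂ (φ i)).ψ X‖₊ : ℝ≥0∞)) ^ 2) + ((∫⁻ X in {X : Config N | ∃ i j : Fin N, i ≠ j ∧ ∃ n : Fin 3 → ℤ,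
        a + δ < ‖X i - X j - latticeVec L n‖ ∧ ‖X i - X j - latticeVec L n‖ < a + δ + δ} ∩ cellN N L, ((‖(Ψ₁ (φ i)).ψ X‖₊ : ℝ≥0∞)) ^ 2) + (∫⁻ X in {X : Config N | ∃ i j : Fin N, i ≠ j ∧ ∃ n : Fin 3 → ℤ,
        a + δ < ‖X i - X j - latticeVec L n‖ ∧ ‖X i - X j - latticeVec L n‖ < a + δ + δ} ∩ cellN N L, ((‖(Ψ₂ (φ i)).ψ X‖₊ : ℝ≥0∞)) ^ 2))).toReal with hηdef
  have hη0 : 0 ≤ η := ENNReal.toReal_nonneg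
  have hηle : η ≤ η₀ :=
    eta_bound_ennreal_ofReal hK hE hCs0 hδ hℓa hV hε₁ hmK2 hmO2 hcoreA hinnerA hshellA hKlE hm1 hε₁a
  have hη8 : η ≤ 1 / 8 := hηle.trans hη₀a
  have hηE : ENNReal.ofReal η = (∫⁻ X in {X : Config N | ∃ i j : Fin N, i ≠ j ∧ ∃ n : Fin 3 → ℤ,
        ‖X i - X j - latticeVec L n‖ < a + δ} ∩ cellN N L, ((‖(Ψ₁ (φ i)).ψ X‖₊ : ℝ≥0∞)) ^ 2) + (∫⁻ X in {X : Config N | ∃ i j : Fin N, i ≠ j ∧ ∃ n : Fin 3 → ℤ,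
        ‖X i - X j - latticeVec L n‖ < a + δ} ∩ cellN N L, ((‖(Ψ₂ (φ i)).ψ X‖₊ : ℝ≥0∞)) ^ 2) + ((∫⁻ X in {X : Config N | ∃ i j : Fin N, i ≠ j ∧ ∃ n : Fin 3 → ℤ,
        a + δ < ‖X i - X j - latticeVec L n‖ ∧ ‖X i - X j - latticeVec L n‖ < a + δ + δ} ∩ cellN N L, ((‖(Ψ₁ (φ i)).ψ X‖₊ : ℝ≥0∞)) ^ 2) + (∫⁻ X in {X : Config N | ∃ i j : Fin N, i ≠ j ∧ ∃ n : Fin 3 → ℤ,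
        a + δ < ‖X i - X j - latticeVec L n‖ ∧ ‖X i - X j - latticeVec L n‖ < a + δ + δ} ∩ cellN N L, ((‖(Ψ₂ (φ i)).ψ X‖₊ : ℝ≥0∞)) ^ 2)) := ENNReal.ofReal_toReal hηfin
  -- the Gram–Schmidt hypotheses
  have hlow : ∀ ⦃μ mKj mOj : ℝ≥0∞⦄, 1 ≤ μ + mKj + mOj → mKj + mOj ≤ ENNReal.ofReal η → ENNReal.ofReal (1 - η) ≤ μ := by
    intro μ mKj mOj h1 h2
    rw [ENNReal.ofReal_sub _ hη0, ENNReal.ofReal_one]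
    refine tsub_le_iff_right.2 ?_
    calc (1 : ℝ≥0∞) ≤ μ + mKj + mOj := h1
      _ = μ + (mKj + mOj) := add_assoc _ _ _
      _ ≤ μ + ENNReal.ofReal η := add_le_add le_rfl h2
  have hpart₁ : (∫⁻ X in {X : Config N | ∃ i j : Fin N, i ≠ j ∧ ∃ n : Fin 3 → ℤ,
        ‖X i - X j - latticeVec L n‖ < a + δ} ∩ cellN N L, ((‖(Ψ₁ (φ i)).ψ X‖₊ : ℝ≥0∞)) ^ 2) + (∫⁻ X in {X : Config N | ∃ i j : Fin N, i ≠ j ∧ ∃ n : Fin 3 → ℤ,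
        a + δ < ‖X i - X j - latticeVec L n‖ ∧ ‖X i - X j - latticeVec L n‖ < a + δ + δ} ∩ cellN N L, ((‖(Ψ₁ (φ i)).ψ X‖₊ : ℝ≥0∞)) ^ 2) ≤ ENNReal.ofReal η := by
    rw [hηE]
    calc (∫⁻ X in {X : Config N | ∃ i j : Fin N, i ≠ j ∧ ∃ n : Fin 3 → ℤ,
        ‖X i - X j - latticeVec L n‖ < a + δ} ∩ cellN N L, ((‖(Ψ₁ (φ i)).ψ X‖₊ : ℝ≥0∞)) ^ 2) + (∫⁻ X in {X : Config N | ∃ i j : Fin N, i ≠ j ∧ ∃ n : Fin 3 → ℤ,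
        a + δ < ‖X i - X j - latticeVec L n‖ ∧ ‖X i - X j - latticeVec L n‖ < a + δ + δ} ∩ cellN N L, ((‖(Ψ₁ (φ i)).ψ X‖₊ : ℝ≥0∞)) ^ 2) ≤ ((∫⁻ X in {X : Config N | ∃ i j : Fin N, i ≠ j ∧ ∃ n : Fin 3 → ℤ,
        ‖X i - X j - latticeVec L n‖ < a + δ} ∩ cellN N L, ((‖(Ψ₁ (φ i)).ψ X‖₊ : ℝ≥0∞)) ^ 2) + (∫⁻ X in {X : Config N | ∃ i j : Fin N, i ≠ j ∧ ∃ n : Fin 3 → ℤ,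
        ‖X i - X j - latticeVec L n‖ < a + δ} ∩ cellN N L, ((‖(Ψ₂ (φ i)).ψ X‖₊ : ℝ≥0∞)) ^ 2)) + ((∫⁻ X in {X : Config N | ∃ i j : Fin N, i ≠ j ∧ ∃ n : Fin 3 → ℤ,
        a + δ < ‖X i - X j - latticeVec L n‖ ∧ ‖X i - X j - latticeVec L n‖ < a + δ + δ} ∩ cellN N L, ((‖(Ψ₁ (φ i)).ψ X‖₊ : ℝ≥0∞)) ^ 2) + (∫⁻ X in {X : Config N | ∃ i j : Fin N, i ≠ j ∧ ∃ n : Fin 3 → ℤ,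
        a + δ < ‖X i - X j - latticeVec L n‖ ∧ ‖X i - X j - latticeVec L n‖ < a + δ + δ} ∩ cellN N L, ((‖(Ψ₂ (φ i)).ψ X‖₊ : ℝ≥0∞)) ^ 2)) := add_le_add le_self_add le_self_add
      _ = _ := rfl
  have hpart₂ : (∫⁻ X in {X : Config N | ∃ i j : Fin N, i ≠ j ∧ ∃ n : Fin 3 → ℤ,
        ‖X i - X j - latticeVec L n‖ < a + δ} ∩ cellN N L, ((‖(Ψ₂ (φ i)).ψ X‖₊ : ℝ≥0∞)) ^ 2) + (∫⁻ X in {X : Config N | ∃ i j : Fin N, i ≠ j ∧ ∃ n : Fin 3 → ℤ,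
        a + δ < ‖X i - X j - latticeVec L n‖ ∧ ‖X i - X j - latticeVec L n‖ < a + δ + δ} ∩ cellN N L, ((‖(Ψ₂ (φ i)).ψ X‖₊ : ℝ≥0∞)) ^ 2) ≤ ENNReal.ofReal η := by
    rw [hηE]
    calc (∫⁻ X in {X : Config N | ∃ i j : Fin N, i ≠ j ∧ ∃ n : Fin 3 → ℤ,
        ‖X i - X j - latticeVec L n‖ < a + δ} ∩ cellN N L, ((‖(Ψ₂ (φ i)).ψ X‖₊ : ℝ≥0∞)) ^ 2) + (∫⁻ X in {X : Config N | ∃ i j : Fin N, i ≠ j ∧ ∃ n : Fin 3 → ℤ,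
        a + δ < ‖X i - X j - latticeVec L n‖ ∧ ‖X i - X j - latticeVec L n‖ < a + δ + δ} ∩ cellN N L, ((‖(Ψ₂ (φ i)).ψ X‖₊ : ℝ≥0∞)) ^ 2) ≤ ((∫⁻ X in {X : Config N | ∃ i j : Fin N, i ≠ j ∧ ∃ n : Fin 3 → ℤ,
        ‖X i - X j - latticeVec L n‖ < a + δ} ∩ cellN N L, ((‖(Ψ₁ (φ i)).ψ X‖₊ : ℝ≥0∞)) ^ 2) + (∫⁻ X in {X : Config N | ∃ i j : Fin N, i ≠ j ∧ ∃ n : Fin 3 → ℤ,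
        ‖X i - X j - latticeVec L n‖ < a + δ} ∩ cellN N L, ((‖(Ψ₂ (φ i)).ψ X‖₊ : ℝ≥0∞)) ^ 2)) + ((∫⁻ X in {X : Config N | ∃ i j : Fin N, i ≠ j ∧ ∃ n : Fin 3 → ℤ,
        a + δ < ‖X i - X j - latticeVec L n‖ ∧ ‖X i - X j - latticeVec L n‖ < a + δ + δ} ∩ cellN N L, ((‖(Ψ₁ (φ i)).ψ X‖₊ : ℝ≥0∞)) ^ 2) + (∫⁻ X in {X : Config N | ∃ i j : Fin N, i ≠ j ∧ ∃ n : Fin 3 → ℤ,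
        a + δ < ‖X i - X j - latticeVec L n‖ ∧ ‖X i - X j - latticeVec L n‖ < a + δ + δ} ∩ cellN N L, ((‖(Ψ₂ (φ i)).ψ X‖₊ : ℝ≥0∞)) ^ 2)) := add_le_add le_add_self le_add_self
      _ = _ := rfl
  have hlow₁ := hlow h2E₁ hpart₁
  have hlow₂ := hlow h2E₂ hpart₂
  have hup : ∀ ⦃μ : ℝ≥0∞⦄, μ ≤ 1 → μ ≤ ENNReal.ofReal (1 + η) := by
    intro μ h
    exact h.trans (by rw [← ENNReal.ofReal_one]; exact ENNReal.ofReal_le_ofReal (by linarith))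
  have hovη : ‖∫ X in cellN N L, conj ((χ X : ℂ) * (Ψ₁ (φ i)).ψ X) * ((χ X : ℂ) * (Ψ₂ (φ i)).ψ X)‖ ≤ η := by
    have hc : (∫⁻ X in {X : Config N | ∃ i j : Fin N, i ≠ j ∧ ∃ n : Fin 3 → ℤ,
        ‖X i - X j - latticeVec L n‖ ≤ a + δ} ∩ cellN N L, ((‖(Ψ₁ (φ i)).ψ X‖₊ : ℝ≥0∞)) ^ 2) + (∫⁻ X in {X : Config N | ∃ i j : Fin N, i ≠ j ∧ ∃ n : Fin 3 → ℤ,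
        a + δ < ‖X i - X j - latticeVec L n‖ ∧ ‖X i - X j - latticeVec L n‖ < a + δ + δ} ∩ cellN N L, ((‖(Ψ₁ (φ i)).ψ X‖₊ : ℝ≥0∞)) ^ 2) + (∫⁻ X in {X : Config N | ∃ i j : Fin N, i ≠ j ∧ ∃ n : Fin 3 → ℤ,
        ‖X i - X j - latticeVec L n‖ ≤ a + δ} ∩ cellN N L, ((‖(Ψ₂ (φ i)).ψ X‖₊ : ℝ≥0∞)) ^ 2) + (∫⁻ X in {X : Config N | ∃ i j : Fin N, i ≠ j ∧ ∃ n : Fin 3 → ℤ,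
        a + δ < ‖X i - X j - latticeVec L n‖ ∧ ‖X i - X j - latticeVec L n‖ < a + δ + δ} ∩ cellN N L, ((‖(Ψ₂ (φ i)).ψ X‖₊ : ℝ≥0∞)) ^ 2) ≤ (∫⁻ X in {X : Config N | ∃ i j : Fin N, i ≠ j ∧ ∃ n : Fin 3 → ℤ,
        ‖X i - X j - latticeVec L n‖ < a + δ} ∩ cellN N L, ((‖(Ψ₁ (φ i)).ψ X‖₊ : ℝ≥0∞)) ^ 2) + (∫⁻ X in {X : Config N | ∃ i j : Fin N, i ≠ j ∧ ∃ n : Fin 3 → ℤ,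
        ‖X i - X j - latticeVec L n‖ < a + δ} ∩ cellN N L, ((‖(Ψ₂ (φ i)).ψ X‖₊ : ℝ≥0∞)) ^ 2) + ((∫⁻ X in {X : Config N | ∃ i j : Fin N, i ≠ j ∧ ∃ n : Fin 3 → ℤ,
        a + δ < ‖X i - X j - latticeVec L n‖ ∧ ‖X i - X j - latticeVec L n‖ < a + δ + δ} ∩ cellN N L, ((‖(Ψ₁ (φ i)).ψ X‖₊ : ℝ≥0∞)) ^ 2) + (∫⁻ X in {X : Config N | ∃ i j : Fin N, i ≠ j ∧ ∃ n : Fin 3 → ℤ,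
        a + δ < ‖X i - X j - latticeVec L n‖ ∧ ‖X i - X j - latticeVec L n‖ < a + δ + δ} ∩ cellN N L, ((‖(Ψ₂ (φ i)).ψ X‖₊ : ℝ≥0∞)) ^ 2)) :=
      calc _ ≤ _ :=
            add_le_add (add_le_add (add_le_add (setLIntegral_hardSet_le_open N L (a + δ) _) le_rfl)
              (setLIntegral_hardSet_le_open N L (a + δ) _)) le_rfl
        _ = _ := by ring
    have h1 : ((∫⁻ X in {X : Config N | ∃ i j : Fin N, i ≠ j ∧ ∃ n : Fin 3 → ℤ,
        ‖X i - X j - latticeVec L n‖ ≤ a + δ} ∩ cellN N L, ((‖(Ψ₁ (φ i)).ψ X‖₊ : ℝ≥0∞)) ^ 2) + (∫⁻ X in {X : Config N | ∃ i j : Fin N, i ≠ j ∧ ∃ n : Fin 3 → ℤ,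
        a + δ < ‖X i - X j - latticeVec L n‖ ∧ ‖X i - X j - latticeVec L n‖ < a + δ + δ} ∩ cellN N L, ((‖(Ψ₁ (φ i)).ψ X‖₊ : ℝ≥0∞)) ^ 2) + (∫⁻ X in {X : Config N | ∃ i j : Fin N, i ≠ j ∧ ∃ n : Fin 3 → ℤ,
        ‖X i - X j - latticeVec L n‖ ≤ a + δ} ∩ cellN N L, ((‖(Ψ₂ (φ i)).ψ X‖₊ : ℝ≥0∞)) ^ 2) + (∫⁻ X in {X : Config N | ∃ i j : Fin N, i ≠ j ∧ ∃ n : Fin 3 → ℤ,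
        a + δ < ‖X i - X j - latticeVec L n‖ ∧ ‖X i - X j - latticeVec L n‖ < a + δ + δ} ∩ cellN N L, ((‖(Ψ₂ (φ i)).ψ X‖₊ : ℝ≥0∞)) ^ 2)).toReal ≤ η := by
      rw [hηdef]; exact ENNReal.toReal_mono hηfin hc
    have h2 : 0 ≤ ((∫⁻ X in {X : Config N | ∃ i j : Fin N, i ≠ j ∧ ∃ n : Fin 3 → ℤ,
        ‖X i - X j - latticeVec L n‖ ≤ a + δ} ∩ cellN N L, ((‖(Ψ₁ (φ i)).ψ X‖₊ : ℝ≥0∞)) ^ 2) + (∫⁻ X in {X : Config N | ∃ i j : Fin N, i ≠ j ∧ ∃ n : Fin 3 → ℤ,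
        a + δ < ‖X i - X j - latticeVec L n‖ ∧ ‖X i - X j - latticeVec L n‖ < a + δ + δ} ∩ cellN N L, ((‖(Ψ₁ (φ i)).ψ X‖₊ : ℝ≥0∞)) ^ 2) + (∫⁻ X in {X : Config N | ∃ i j : Fin N, i ≠ j ∧ ∃ n : Fin 3 → ℤ,
        ‖X i - X j - latticeVec L n‖ ≤ a + δ} ∩ cellN N L, ((‖(Ψ₂ (φ i)).ψ X‖₊ : ℝ≥0∞)) ^ 2) + (∫⁻ X in {X : Config N | ∃ i j : Fin N, i ≠ j ∧ ∃ n : Fin 3 → ℤ,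
        a + δ < ‖X i - X j - latticeVec L n‖ ∧ ‖X i - X j - latticeVec L n‖ < a + δ + δ} ∩ cellN N L, ((‖(Ψ₂ (φ i)).ψ X‖₊ : ℝ≥0∞)) ^ 2)).toReal := ENNReal.toReal_nonneg
    refine hovE.trans ?_
    linarith
  obtain ⟨f₁, f₂, hforth, hfE⟩ := stub_gramSchmidtPair v hv.1 N L hL η hη0 hη8 _ _ (hu _) (hu _) (huper _) (huper _)
    (husymm _) (husymm _) hlow₁ (hup hμ1₁) hlow₂ (hup hμ1₂) hovη
  -- the variational principle for `K₂(v)` and the final bookkeeping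
  have hKf : kyFanTwo v N L ≤ periodicEnergy v f₁ + periodicEnergy v f₂ :=
    iInf_le_of_le f₁ (iInf_le_of_le f₂ (iInf_le_of_le hforth le_rfl))
  have hGSE := hKf.trans hfE
  have hq : (∫⁻ X in cellN N L, kineticDensity (fun Y => (χ Y : ℂ) * (Ψ₁ (φ i)).ψ Y) X +
        periodicInteraction v L X * ((‖(χ X : ℂ) * (Ψ₁ (φ i)).ψ X‖₊ : ℝ≥0∞)) ^ 2) + (∫⁻ X in cellN N L, kineticDensity (fun Y => (χ Y : ℂ) * (Ψ₂ (φ i)).ψ Y) X +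
        periodicInteraction v L X * ((‖(χ X : ℂ) * (Ψ₂ (φ i)).ψ X‖₊ : ℝ≥0∞)) ^ 2) ≤
      ENNReal.ofReal (1 + θ) * (periodicEnergy (fun r => min (v r) ((φ i : ℕ) : ℝ≥0∞)) (Ψ₁ (φ i)) + periodicEnergy (fun r => min (v r) ((φ i : ℕ) : ℝ≥0∞)) (Ψ₂ (φ i))) + ENNReal.ofReal ((1 + θ⁻¹) * (Cχ / δ ^ 2)) * ((∫⁻ X in {X : Config N | ∃ i j : Fin N, i ≠ j ∧ ∃ n : Fin 3 → ℤ,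
        a + δ < ‖X i - X j - latticeVec L n‖ ∧ ‖X i - X j - latticeVec L n‖ < a + δ + δ} ∩ cellN N L, ((‖(Ψ₁ (φ i)).ψ X‖₊ : ℝ≥0∞)) ^ 2) + (∫⁻ X in {X : Config N | ∃ i j : Fin N, i ≠ j ∧ ∃ n : Fin 3 → ℤ,
        a + δ < ‖X i - X j - latticeVec L n‖ ∧ ‖X i - X j - latticeVec L n‖ < a + δ + δ} ∩ cellN N L, ((‖(Ψ₂ (φ i)).ψ X‖₊ : ℝ≥0∞)) ^ 2)) :=
    calc _ ≤ _ := add_le_add h4E₁ h4E₂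
      _ = _ := by ring
  have key : kyFanTwo v N L ≤ kyFanTwo (fun r => min (v r) ((φ i : ℕ) : ℝ≥0∞)) N L + ENNReal.ofReal ε :=
    final_ennreal_ofReal hK (hKn (φ i)) hθ hη0 hηle hη₀a hCs0 hCχ0 hδ hmpos hV hε hε₁ hmK2 hmO2 hGSE hq (hopt (φ i)) hcoreA
      hinnerA hshellA hKlE hθK hη₀b hm2 hm3 hε₁b
  -- monotonicity in the truncation level
  refine ⟨φ i, fun n hn => key.trans ?_⟩
  have hmn : ((φ i : ℕ) : ℝ≥0∞) ≤ (n : ℝ≥0∞) := by exact_mod_cast hn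
  exact add_le_add_left (kyFanTwo_mono_of_le fun r => min_le_min_left (v r) hmn) _


end Summit.AtomisticToContinuum.BoseEinsteinCondensation.Cruxes.HardCoreExtension.ThirdLawCurrentFloor

end
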